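/-
Copyright (c) 2026 the pub-hodgecm-mathlib formalisation cell (harness21).  Prover seat hodgecm-mathlib-B-p14 (g30), (F11) «ramified torus `(EL)¹ × E¹`», sub-brick
(F2′) «UNFOLDING OVER THE ANISOTROPIC DOUBLE COSETS» (architect A-p06 (g26); dress pattern of B-p12 (g28)'s ★ (F2b) `UnitOrbitalIntegralUnfoldingHK`), 2026-09-01.
-/
import Literature.NumberTheory.Automorphic.UnitaryThreeDoubleCosetsAnisotropic   -- ★ p841283 (this seat): (A′) existence, (B′) disjointness
import Literature.NumberTheory.Automorphic.FixedPointsDoubleCosetUnfolding      -- ★ p840887 (B-p12): (F2a) abstract unfolding `Fix_t(G⧸K) ≃ Σᵢ Fix_t(H⧸Hᵢ)`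
import HarnessLib

/-!
# Flicker's Proposition 5 (last claim) for the `κ = −1` class of a type-(2) element: the unfolding of `Φ′(t″)` over `G = ⊔_m H″ d_m K`
# (Flicker 1998, Prop. 5 p. 82: «`∫_{G∕K} 1_K(x⁻¹tx) dx = Σ_{m ≥ 0} ∫_{H′∕H′_m} 1_{H′_m}(h⁻¹t′h) dh`»)

Topic `NumberTheory/Automorphic`; namespace `Literature.NumberTheory.Automorphic.UnitaryGroup`.  THEOREMS ONLY (no `def`, no instance, no notation, no named fact,
no `sorry`).  Cell `pub/hodgecm-mathlib`, crux H413 = `stmt-HodgeConjecture-24833`, road «N7-ns COUNT FROM FLICKER» (MAP v3, architect A-p06 (g26)), line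
«N7nsCount», brick (F11), sub-brick **(F2′)**: ★ (F2a) `DoubleCosetFixedPoints.natCard_fixedPoints_eq_finsum` (B-p12) instantiated with the ANISOTROPIC data of
★ (F1′) p841283 — `H″ := MulAction.stabilizer U w₀` (the pointwise stabiliser of `w₀ = ![1, 0, −2ϖ]` under the `mulVec` action of `U ≤ GL₃(K)` on `K³`;
Flicker's `gH′g⁻¹ = Stab(ν₀)`), representatives `d_m = diag(ϖ^m, 1, ϖ^{−m})` (a family `d : ℕ → U` given with its matrices, as ★ (F2b) takes `u_m`), `K₀ = unitaryInt`.
* `mem_stabilizer_anisoVec_iff` — `h ∈ H″ ↔ ↑↑h *ᵥ w₀ = w₀` (`rfl`-level);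
* `flickerDiag_doubleCoset_cover_and_disjoint` — (A′)(B′) in (F2a)'s `hA`∕`hB` shape;
* **`natCard_fixedPoints_unitaryInt_eq_finsum_flickerDiag`** — for `t ∈ H″` with finitely many fixed points on `U ⧸ K₀`:
  `#{q ∈ U ⧸ K₀ : t • q = q} = Σᶠ_m #{z ∈ H″ ⧸ H′_m : t • z = z}`, `H′_m = H″ ∩ d_m K₀ d_m⁻¹` — Flicker's unfolding of `Φ′(t″)` with counting measures
  (★ `orbitalIntegral_indicator_quotientMeasure_eq_natCard_fixedPoints`: `vol K = 1`, compact-torus mass one); + the bijection and finiteness forms, and the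
  summand's condition `t • (h H′_m) = h H′_m ↔ (h d_m)⁻¹ t (h d_m) ∈ K₀` (Flicker's `1_{H′_m}(h⁻¹ t′ h)`, the input of Prop. 16's count).
HONEST LABEL: HC_CM is proved only modulo the printed citations until rung 0 closes; structure theory feeding ONE value stub of #103-ns, pays nothing by itself.

## References
* [Flicker1998UnitaryFL] Y. Z. Flicker, *Elementary proof of the fundamental lemma for a unitary group*, Canad. J. Math. 50 (1998), Prop. 4 pp. 80–82, Prop. 5 p. 82,
  Prop. 16 p. 96.
* [Rogawski1990] J. D. Rogawski, *Automorphic Representations of Unitary Groups in Three Variables* (1990), §4.9 p. 54.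
-/

set_option autoImplicit false

noncomputable section

open scoped MatrixGroups WithZero
open Matrix

namespace Literature.NumberTheory.Automorphic

namespace UnitaryGroup

open Literature.NumberTheory.Automorphic.HermitianLattice
open Literature.NumberTheory.Automorphic.DoubleCosetFixedPoints

variable {K : Type*} [Field K] [Valued K ℤᵐ⁰] {ϖ : K}
  (σ : K →+* K) {J : Matrix (Fin 3) (Fin 3) K} (hJ : J = (StdForm.antidiagonal 3).over K)

omit [Valued K ℤᵐ⁰] in
/-- **`H″ = Stab_U(w₀)` as a subgroup**: membership in `MulAction.stabilizer U w₀` (the action of `U ≤ GL₃(K)` on `K³` is `mulVec`) is the equation `h · w₀ = w₀`.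
[cite: Flicker1998UnitaryFL, Prop. 4 p. 81] -/
theorem mem_stabilizer_anisoVec_iff (w₀ : Fin 3 → K) (h : ↥(unitaryGroupOfForm σ J)) :
    h ∈ MulAction.stabilizer (↥(unitaryGroupOfForm σ J)) w₀ ↔ ((h : GL (Fin 3) K) : Matrix (Fin 3) (Fin 3) K) *ᵥ w₀ = w₀ :=
  MulAction.mem_stabilizer_iff

include hJ in
/-- (F1′) in the abstract shape `hA`∕`hB` of ★ (F2a): with the representatives `d_m` (given with their matrices), every `g ∈ U` is `h d_m k` (`h ∈ H″ = Stab(w₀)`,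
`k ∈ K₀`) and the index `m` of the double coset `H″ g K₀` is unique. [cite: Flicker1998UnitaryFL, Prop. 4 pp. 80–82] -/
theorem flickerDiag_doubleCoset_cover_and_disjoint (hd : LocalConjDatum σ ϖ) (d : ℕ → ↥(unitaryGroupOfForm σ J))
    (hdm : ∀ m, ((d m : GL (Fin 3) K) : Matrix (Fin 3) (Fin 3) K) = !![ϖ ^ m, 0, 0; 0, 1, 0; 0, 0, (ϖ ^ m)⁻¹]) :
    (∀ g : ↥(unitaryGroupOfForm σ J), ∃ m, ∃ h ∈ MulAction.stabilizer (↥(unitaryGroupOfForm σ J)) (![1, 0, -(2 * ϖ)] : Fin 3 → K),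
        ∃ k ∈ unitaryInt σ J, g = h * d m * k) ∧
      ∀ m n, ∀ h ∈ MulAction.stabilizer (↥(unitaryGroupOfForm σ J)) (![1, 0, -(2 * ϖ)] : Fin 3 → K),
        ∀ h' ∈ MulAction.stabilizer (↥(unitaryGroupOfForm σ J)) (![1, 0, -(2 * ϖ)] : Fin 3 → K),
        ∀ k ∈ unitaryInt σ J, ∀ k' ∈ unitaryInt σ J, h * d m * k = h' * d n * k' → m = n := by
  refine ⟨fun g => ?_, fun m n h hh h' hh' k hk k' hk' heq => ?_⟩
  · obtain ⟨m, h, d', k, hh, hd', hk, hg⟩ := exists_stabilizer_mul_flickerDiag_mul_unitaryInt σ hJ hd g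
    have hdd : d' = d m := Subtype.ext (Matrix.GeneralLinearGroup.ext fun i j => by rw [hd', hdm m])
    exact ⟨m, h, (mem_stabilizer_anisoVec_iff σ _ h).2 hh, k, hk, by rw [hg, hdd]⟩
  · have hh1 : ((h : GL (Fin 3) K) : Matrix (Fin 3) (Fin 3) K) *ᵥ ![1, 0, -(2 * ϖ)] = (1 : K) • ![1, 0, -(2 * ϖ)] := by
      rw [one_smul]; exact (mem_stabilizer_anisoVec_iff σ _ h).1 hh
    have hh'1 : ((h' : GL (Fin 3) K) : Matrix (Fin 3) (Fin 3) K) *ᵥ ![1, 0, -(2 * ϖ)] = (1 : K) • ![1, 0, -(2 * ϖ)] := by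
      rw [one_smul]; exact (mem_stabilizer_anisoVec_iff σ _ h').1 hh'
    exact eq_of_stabilizer_mul_flickerDiag_mul_unitaryInt_eq σ hJ hd hh1 (hdm m) hk hh'1 (hdm n) hk' heq

set_option synthInstance.maxHeartbeats 200000 in
-- the `H″`-action on `H″ ⧸ H′_m` is found through the large subgroup terms of the `U(2,1)` frame (as in ★ (F2b))
include hJ in
/-- **FLICKER'S PROPOSITION 5 (bijection form) over the anisotropic double cosets**: for `t ∈ H″ = Stab(w₀)`, the `t`-fixed points of `U ⧸ K₀` are in bijection with
`Σ_m {hH′_m ∈ H″ ⧸ H′_m : t • hH′_m = hH′_m}`, `H′_m = H″ ∩ d_m K₀ d_m⁻¹`. [cite: Flicker1998UnitaryFL, Prop. 5 p. 82] -/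
theorem exists_equiv_fixedPoints_sigma_flickerDiag (hd : LocalConjDatum σ ϖ) (d : ℕ → ↥(unitaryGroupOfForm σ J))
    (hdm : ∀ m, ((d m : GL (Fin 3) K) : Matrix (Fin 3) (Fin 3) K) = !![ϖ ^ m, 0, 0; 0, 1, 0; 0, 0, (ϖ ^ m)⁻¹])
    {t : ↥(unitaryGroupOfForm σ J)} (ht : t ∈ MulAction.stabilizer (↥(unitaryGroupOfForm σ J)) (![1, 0, -(2 * ϖ)] : Fin 3 → K)) :
    Nonempty ({q : ↥(unitaryGroupOfForm σ J) ⧸ unitaryInt σ J // t • q = q} ≃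
      Σ m : ℕ, {z : ↥(MulAction.stabilizer (↥(unitaryGroupOfForm σ J)) (![1, 0, -(2 * ϖ)] : Fin 3 → K)) ⧸
          ((unitaryInt σ J).map (MulAut.conj (d m)).toMonoidHom).subgroupOf
            (MulAction.stabilizer (↥(unitaryGroupOfForm σ J)) (![1, 0, -(2 * ϖ)] : Fin 3 → K)) //
        (⟨t, ht⟩ : ↥(MulAction.stabilizer (↥(unitaryGroupOfForm σ J)) (![1, 0, -(2 * ϖ)] : Fin 3 → K))) • z = z}) := by
  obtain ⟨hA, hB⟩ := flickerDiag_doubleCoset_cover_and_disjoint σ hJ hd d hdm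
  exact exists_equiv_fixedPoints_sigma _ _ d hA hB ht

set_option synthInstance.maxHeartbeats 200000 in
-- as above
include hJ in
/-- **FLICKER'S PROPOSITION 5 (counted) over the anisotropic double cosets — the unfolding of `Φ′(t″)`**: for `t ∈ H″ = Stab(w₀)` with finitely many fixed points
on `U ⧸ K₀`, **`#{q ∈ U ⧸ K₀ : t • q = q} = Σᶠ_{m ≥ 0} #{hH′_m : t • hH′_m = hH′_m}`**, `H′_m = H″ ∩ d_m K₀ d_m⁻¹` — «`Φ′(t″) = Σ_m ∫_{H′∕H′_m} 1_{H′_m}(h⁻¹t′h) dh`»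
with counting measures. [cite: Flicker1998UnitaryFL, Prop. 5 p. 82; Prop. 17 p. 97 (proof)] -/
theorem natCard_fixedPoints_unitaryInt_eq_finsum_flickerDiag (hd : LocalConjDatum σ ϖ) (d : ℕ → ↥(unitaryGroupOfForm σ J))
    (hdm : ∀ m, ((d m : GL (Fin 3) K) : Matrix (Fin 3) (Fin 3) K) = !![ϖ ^ m, 0, 0; 0, 1, 0; 0, 0, (ϖ ^ m)⁻¹])
    {t : ↥(unitaryGroupOfForm σ J)} (ht : t ∈ MulAction.stabilizer (↥(unitaryGroupOfForm σ J)) (![1, 0, -(2 * ϖ)] : Fin 3 → K))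
    (hfin : {q : ↥(unitaryGroupOfForm σ J) ⧸ unitaryInt σ J | t • q = q}.Finite) :
    Nat.card {q : ↥(unitaryGroupOfForm σ J) ⧸ unitaryInt σ J | t • q = q} =
      ∑ᶠ m : ℕ, Nat.card {z : ↥(MulAction.stabilizer (↥(unitaryGroupOfForm σ J)) (![1, 0, -(2 * ϖ)] : Fin 3 → K)) ⧸
          ((unitaryInt σ J).map (MulAut.conj (d m)).toMonoidHom).subgroupOf
            (MulAction.stabilizer (↥(unitaryGroupOfForm σ J)) (![1, 0, -(2 * ϖ)] : Fin 3 → K)) |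
        (⟨t, ht⟩ : ↥(MulAction.stabilizer (↥(unitaryGroupOfForm σ J)) (![1, 0, -(2 * ϖ)] : Fin 3 → K))) • z = z} := by
  obtain ⟨hA, hB⟩ := flickerDiag_doubleCoset_cover_and_disjoint σ hJ hd d hdm
  exact natCard_fixedPoints_eq_finsum _ _ d hA hB ht hfin

set_option synthInstance.maxHeartbeats 200000 in
-- as above
include hJ in
/-- Only finitely many anisotropic double cosets `H″ d_m K₀` carry a `t`-fixed point, and each carries finitely many (so the `Σᶠ` above is an honest finite sum
«`0 ≤ m ≤ min(…)`», Props. 16–17). [cite: Flicker1998UnitaryFL, Prop. 5 p. 82; Prop. 17 p. 97] -/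
theorem finite_setOf_nonempty_fixedPoints_flickerDiag (hd : LocalConjDatum σ ϖ) (d : ℕ → ↥(unitaryGroupOfForm σ J))
    (hdm : ∀ m, ((d m : GL (Fin 3) K) : Matrix (Fin 3) (Fin 3) K) = !![ϖ ^ m, 0, 0; 0, 1, 0; 0, 0, (ϖ ^ m)⁻¹])
    {t : ↥(unitaryGroupOfForm σ J)} (ht : t ∈ MulAction.stabilizer (↥(unitaryGroupOfForm σ J)) (![1, 0, -(2 * ϖ)] : Fin 3 → K))
    (hfin : {q : ↥(unitaryGroupOfForm σ J) ⧸ unitaryInt σ J | t • q = q}.Finite) :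
    {m : ℕ | Nonempty {z : ↥(MulAction.stabilizer (↥(unitaryGroupOfForm σ J)) (![1, 0, -(2 * ϖ)] : Fin 3 → K)) ⧸
          ((unitaryInt σ J).map (MulAut.conj (d m)).toMonoidHom).subgroupOf
            (MulAction.stabilizer (↥(unitaryGroupOfForm σ J)) (![1, 0, -(2 * ϖ)] : Fin 3 → K)) //
        (⟨t, ht⟩ : ↥(MulAction.stabilizer (↥(unitaryGroupOfForm σ J)) (![1, 0, -(2 * ϖ)] : Fin 3 → K))) • z = z}}.Finite ∧
      ∀ m : ℕ, Finite {z : ↥(MulAction.stabilizer (↥(unitaryGroupOfForm σ J)) (![1, 0, -(2 * ϖ)] : Fin 3 → K)) ⧸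
          ((unitaryInt σ J).map (MulAut.conj (d m)).toMonoidHom).subgroupOf
            (MulAction.stabilizer (↥(unitaryGroupOfForm σ J)) (![1, 0, -(2 * ϖ)] : Fin 3 → K)) //
        (⟨t, ht⟩ : ↥(MulAction.stabilizer (↥(unitaryGroupOfForm σ J)) (![1, 0, -(2 * ϖ)] : Fin 3 → K))) • z = z} := by
  obtain ⟨hA, hB⟩ := flickerDiag_doubleCoset_cover_and_disjoint σ hJ hd d hdm
  exact finite_setOf_nonempty_fixedPoints _ _ d hA hB ht hfin

set_option synthInstance.maxHeartbeats 200000 in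
-- as above
/-- The summand's condition in `U`: `t • (h H′_m) = h H′_m ↔ (h d_m)⁻¹ t (h d_m) ∈ K₀` — Flicker's `1_K(d_m⁻¹ h⁻¹ t′ h d_m) = 1_{H′_m}(h⁻¹ t′ h)`, the predicate that
Prop. 16 counts. [cite: Flicker1998UnitaryFL, Prop. 5 p. 82; Prop. 16 p. 96] -/
theorem smul_mk_eq_iff_flickerDiag (d : ℕ → ↥(unitaryGroupOfForm σ J)) (m : ℕ)
    (t h : ↥(MulAction.stabilizer (↥(unitaryGroupOfForm σ J)) (![1, 0, -(2 * ϖ)] : Fin 3 → K))) :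
    t • (QuotientGroup.mk h : ↥(MulAction.stabilizer (↥(unitaryGroupOfForm σ J)) (![1, 0, -(2 * ϖ)] : Fin 3 → K)) ⧸
        ((unitaryInt σ J).map (MulAut.conj (d m)).toMonoidHom).subgroupOf
          (MulAction.stabilizer (↥(unitaryGroupOfForm σ J)) (![1, 0, -(2 * ϖ)] : Fin 3 → K))) =
      QuotientGroup.mk h ↔
        ((h : ↥(unitaryGroupOfForm σ J)) * d m)⁻¹ * (t : ↥(unitaryGroupOfForm σ J)) * ((h : ↥(unitaryGroupOfForm σ J)) * d m) ∈ unitaryInt σ J :=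
  smul_mk_eq_iff _ _ d m t h

end UnitaryGroup

end Literature.NumberTheory.Automorphic

end
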